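import Summits.HodgeConjecture.HodgeConjecture.Theorems.F0P2oThetaTypeJacquetLetterAOfDictionary  -- ★ p834949: letter (a) from one dictionary chart
import HarnessLib

/-!
# Crux `H413`, programme P2, N3 road (a) — THE LETTER-(a) SOCKET IN THE CLOSER'S SPELLING (`toRep ∘ s_v`)
# (a spelling adapter for Jacquet charts exported by the Y-coinvariant files, and letter (a) from such a chart)

Cell hodgecm-mathlib (D-0151), FLOOR 0, crux item H413 = stmt-HodgeConjecture-24833, programme P2; N3 road (a), seat A-p12 (g17).  Service file for the
(S5) hands (F0P2-p01 (g8) `F0P2oYCoinvariantsChart`, B-p18 (g28), F0P2-p06 (g3)): their charts `(π, σ)` of the restricted Weil representation come in the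
spelling of ★ p832817 — `(((MpPsi.toRep (localSchrodinger …)).comp (𝓢.s v)).comp (localLineInl.comp (localPiEquiv.symm.toMonoidHom.comp
(cmDatumLocalCongr T).toMonoidHom))).comp N.subtype` and `π (toRep (s_v (localCenter u)) f) = σ u (π f)` — whereas the letter-(a) socket ★ p834949
`F0P2oThetaTypeJacquetLetterAOfDictionary.nonempty_jacquet_xThetaGqsCM_equiv_weightSpace_of_continuous` is written, like ★ `xThetaCM`, with
★ `FinLocalSplittings.omegaLoc` and the other association.  `chart_omegaLoc_of_chart_toRep` converts the former into the latter by REWRITING (the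
definitional route exhausts the kernel, ★ p834408 KERNEL NOTE), and `nonempty_jacquet_xThetaGqsCM_equiv_weightSpace_of_continuous'` is the socket itself
restated for charts in the closer's spelling: **letter (a) ⟸ one dictionary chart `(π, hπ, hker, σ, hσ, Tr, hTr)` with `hker`, `hσ` as the Y-coinvariant
files print them.** [GelbartRogawski1991 §3.2 p. 457, §5.2 p. 467; Kudla1986 Thm. 2.8; MoeglinVignerasWaldspurger1987 Chap. 2 II.1, Chap. 3 §IV.5.]

## References
* [GelbartRogawski1991] S. Gelbart, J. Rogawski, *L-functions and Fourier–Jacobi coefficients for the unitary group U(3)*, Invent. Math. 105 (1991):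
  §3.2 (3.2.1)–(3.2.3) p. 457; §5.2 p. 467 L25–27.
* [Kudla1986] S. Kudla, *On the local theta-correspondence*, Invent. Math. 83 (1986): Thm. 2.8.
* [MoeglinVignerasWaldspurger1987] C. Mœglin, M.-F. Vignéras, J.-L. Waldspurger, *Correspondances de Howe sur un corps p-adique*, LNM 1291 (1987):
  Chap. 2 II.1; Chap. 3 §IV.5.
-/

set_option autoImplicit false
set_option linter.dupNamespace false -- the mandated namespace repeats the single-problem summit's segment

noncomputable section

open NumberField IsDedekindDomain
open scoped Matrix Kronecker
open Literature.RepresentationTheory Literature.NumberTheory.Automorphic Representation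
open Literature.NumberTheory Literature.NumberTheory.Automorphic.UnitaryGroup
open Literature.NumberTheory.Automorphic.IdeleClassGroup
open Literature.NumberTheory.Automorphic.Liu2021 Literature.NumberTheory.Automorphic.Liu2021.Def411WeilCarriers
open Literature.NumberTheory.GelbartRogawski1991 Literature.NumberTheory.GelbartRogawski1991.UnitaryDualPair
open Literature.NumberTheory.GelbartRogawski1991.UnitaryDualPair.WeilCoinv Literature.NumberTheory.GelbartRogawski1991.UnitaryDualPair.LocalSplitting
open Literature.NumberTheory.GaloisRepresentations Literature.NumberTheory.Rogawski1990
open Literature.RepresentationTheory.Liu2021 Literature.RepresentationTheory.HeisenbergGroup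
open Summit.HodgeConjecture.HodgeConjecture.Cruxes.H413.F0P2oThetaTypeJacquetLetterAOfDictionary

namespace Summit.HodgeConjecture.HodgeConjecture.Cruxes.H413.F0P2oThetaTypeJacquetSocketSpelling

variable (L : Type) [Field L] [NumberField L] [IsCMField L]

set_option synthInstance.maxHeartbeats 400000 in
set_option maxHeartbeats 8000000 in
/-- **SPELLING ADAPTER (closer's spelling ⇒ `xThetaCM`'s spelling) for Jacquet charts.**  The Y-coinvariant files (★ p832817, F0P2-p01 (g8)'s
`F0P2oYCoinvariantsChart`) write the restricted Weil representation as `((toRep ∘ s_v) ∘ (localLineInl ∘ (localPiEquiv⁻¹ ∘ cmDatumLocalCongr T))) ∘ N.subtype`,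
while ★ `xThetaCM` ∕ the sockets of ★ p834408–p834949 write `((omegaLoc ∘ localLineInl) ∘ (localPiEquiv⁻¹ ∘ cmDatumLocalCongr T)) ∘ N.subtype`.  The two are
equal by ★ `FinLocalSplittings.omegaLoc`'s definition and reassociation; this lemma converts a chart `(π, σ)` stated in the first spelling (`hker`, `hσ`) into
the second — by REWRITING (`FinLocalSplittings.omegaLoc`, `MonoidHom.comp_assoc`, `MonoidHom.comp_apply`), which the kernel checks instantly, whereas a
definitional `exact` across the two spellings unfolds the CM package and exhausts memory (★ p834408 KERNEL NOTE). [cite: MoeglinVignerasWaldspurger1987, Chap. 2 II.1]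
[cite: GelbartRogawski1991, §3.2 p. 457] -/
theorem chart_omegaLoc_of_chart_toRep {n' : ℕ} (e₁ : Fin 3 × Fin 1 ≃ Fin n') (dV : Fin 3 → L)
    (hdV : ∀ i, IsCMField.complexConj L (dV i) = dV i) (hdV0 : ∀ i, dV i ≠ 0)
    (μ : Literature.NumberTheory.Automorphic.IdeleClassGroup L →ₜ* Circle) (hμ : IsConjugateSymplectic L μ)
    (ε : (↥(maximalRealSubfield L))ˣ) (v : HeightOneSpectrum (𝓞 ↥(maximalRealSubfield L)))
    (T : GL (Fin 3) (UnitaryGroup.LocalRing L v)) {a : UnitaryGroup.LocalRing L v} (ha : IsUnit a)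
    (h : formCongr (conjLocal L (IsCMField.complexConj L) v) T ((Matrix.diagonal dV).map (algebraMap L (UnitaryGroup.LocalRing L v))) =
      a • (Matrix.of fun i j : Fin 3 => if i.val + j.val + 1 = 3 then (1 : L) else 0).map (algebraMap L (UnitaryGroup.LocalRing L v)))
    {S₁ : Type*} [AddCommGroup S₁] [Module ℂ S₁]
    (π : SchwartzBruhat (Fin n' → v.adicCompletion ↥(maximalRealSubfield L)) →ₗ[ℂ] S₁)
    (hker : LinearMap.ker π = Coinvariants.ker
      ((((MpPsi.toRep (localSchrodinger (↥(maximalRealSubfield L)) n'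
          (gram (↥(maximalRealSubfield L)) e₁ (realDiagonal L dV hdV) (TW (↥(maximalRealSubfield L)) ε)) v)).comp
        ((chiLocalSplittingsCM L e₁ dV hdV hdV0 (toHeckeCharacter L μ) ((isOscillatorChar_toHeckeCharacter_iff μ).mpr hμ) ε).s v)).comp
        ((localLineInl L (IsCMField.complexConj L) 3 e₁ (Matrix.diagonal dV) (JW (↥(maximalRealSubfield L)) L ε) v).comp
          ((localPiEquiv L (IsCMField.complexConj L) 3 (Matrix.diagonal dV) v).symm.toMonoidHom.comp
            (cmDatumLocalCongr L v T ha h).toMonoidHom))).comp (cmBorelTriple L 3 v).N.subtype))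
    (σ : Representation ℂ (localPi L (IsCMField.complexConj L) 1 (JW (↥(maximalRealSubfield L)) L ε) v) S₁)
    (hσ : ∀ (u : localPi L (IsCMField.complexConj L) 1 (JW (↥(maximalRealSubfield L)) L ε) v)
      (f : SchwartzBruhat (Fin n' → v.adicCompletion ↥(maximalRealSubfield L))),
      π (MpPsi.toRep (localSchrodinger (↥(maximalRealSubfield L)) n'
          (gram (↥(maximalRealSubfield L)) e₁ (realDiagonal L dV hdV) (TW (↥(maximalRealSubfield L)) ε)) v)
        ((chiLocalSplittingsCM L e₁ dV hdV hdV0 (toHeckeCharacter L μ) ((isOscillatorChar_toHeckeCharacter_iff μ).mpr hμ) ε).s v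
          (localCenter L (IsCMField.complexConj L) n' (Matrix.reindex e₁ e₁ (Matrix.diagonal dV ⊗ₖ JW (↥(maximalRealSubfield L)) L ε))
            (JW (↥(maximalRealSubfield L)) L ε) (JW_apply_ne_zero (↥(maximalRealSubfield L)) L ε) v u)) f) = σ u (π f))
    :
    (LinearMap.ker π = Coinvariants.ker
      (((((chiLocalSplittingsCM L e₁ dV hdV hdV0 (toHeckeCharacter L μ) ((isOscillatorChar_toHeckeCharacter_iff μ).mpr hμ) ε).omegaLoc v).comp
        (localLineInl L (IsCMField.complexConj L) 3 e₁ (Matrix.diagonal dV) (JW (↥(maximalRealSubfield L)) L ε) v)).comp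
        ((localPiEquiv L (IsCMField.complexConj L) 3 (Matrix.diagonal dV) v).symm.toMulEquiv.toMonoidHom.comp
          (cmDatumLocalCongr L v T ha h : Gqs L v ≃ₜ* (cmDatum L 3 (Matrix.diagonal dV)).Local v).toMulEquiv.toMonoidHom)).comp
        (cmBorelTriple L 3 v).N.subtype)) ∧
    (∀ (u : localPi L (IsCMField.complexConj L) 1 (JW (↥(maximalRealSubfield L)) L ε) v)
      (f : SchwartzBruhat (Fin n' → v.adicCompletion ↥(maximalRealSubfield L))),
      π ((chiLocalSplittingsCM L e₁ dV hdV hdV0 (toHeckeCharacter L μ) ((isOscillatorChar_toHeckeCharacter_iff μ).mpr hμ) ε).omegaLoc v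
        (localCenter L (IsCMField.complexConj L) n' (Matrix.reindex e₁ e₁ (Matrix.diagonal dV ⊗ₖ JW (↥(maximalRealSubfield L)) L ε))
          (JW (↥(maximalRealSubfield L)) L ε) (JW_apply_ne_zero (↥(maximalRealSubfield L)) L ε) v u) f) = σ u (π f)) := by
  refine ⟨?_, fun u f => ?_⟩
  · rw [hker]
    simp only [FinLocalSplittings.omegaLoc, MonoidHom.comp_assoc]
  · rw [FinLocalSplittings.omegaLoc, MonoidHom.comp_apply]
    exact hσ u f

set_option synthInstance.maxHeartbeats 400000 in
set_option maxHeartbeats 8000000 in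
/-- **LETTER (a) FROM ONE (S5) DICTIONARY CHART STATED IN THE CLOSER'S SPELLING** (`toRep ∘ s_v`, as the Y-coinvariant files export their charts):
★ p834949 `nonempty_jacquet_xThetaGqsCM_equiv_weightSpace_of_continuous` after `chart_omegaLoc_of_chart_toRep`.  Conclusion = letter (a) of
★ `thetaType_nonsplit_jacquetModule`, token for token. [cite: GelbartRogawski1991, §3.2 (3.2.1)–(3.2.3) p. 457; §5.2 p. 467 L25–27] [cite: Kudla1986, Thm. 2.8] -/
theorem nonempty_jacquet_xThetaGqsCM_equiv_weightSpace_of_continuous' {n' : ℕ} (e₁ : Fin 3 × Fin 1 ≃ Fin n') (dV : Fin 3 → L)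
    (hdV : ∀ i, IsCMField.complexConj L (dV i) = dV i) (hdV0 : ∀ i, dV i ≠ 0) {n₀ : ℕ} (e₀ : Fin 1 × Fin 1 ≃ Fin n₀)
    (μ : Literature.NumberTheory.Automorphic.IdeleClassGroup L →ₜ* Circle) (hμ : IsConjugateSymplectic L μ)
    (χf : UnitaryGroup.finAdelicOne (↥(maximalRealSubfield L)) L (IsCMField.complexConj L) →* ℂˣ) (ε : (↥(maximalRealSubfield L))ˣ)
    (v : HeightOneSpectrum (𝓞 ↥(maximalRealSubfield L))) (hv : ∀ w : PlacesOver L v, IsCMField.complexConj L • w.1 = w.1)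
    (hχf : Continuous χf) (ψθ : ↥(normOneUnits (conjLocal L (IsCMField.complexConj L) v)) →* ℂˣ) (hψθ : IsThetaCenterChar L μ χf ε v ψθ)
    (T : GL (Fin 3) (UnitaryGroup.LocalRing L v)) {a : UnitaryGroup.LocalRing L v} (ha : IsUnit a)
    (h : formCongr (conjLocal L (IsCMField.complexConj L) v) T ((Matrix.diagonal dV).map (algebraMap L (UnitaryGroup.LocalRing L v))) =
      a • (Matrix.of fun i j : Fin 3 => if i.val + j.val + 1 = 3 then (1 : L) else 0).map (algebraMap L (UnitaryGroup.LocalRing L v)))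
    {S₁ : Type*} [AddCommGroup S₁] [Module ℂ S₁]
    (π : SchwartzBruhat (Fin n' → v.adicCompletion ↥(maximalRealSubfield L)) →ₗ[ℂ] S₁) (hπ : Function.Surjective π)
    (hker : LinearMap.ker π = Coinvariants.ker
      ((((MpPsi.toRep (localSchrodinger (↥(maximalRealSubfield L)) n'
          (gram (↥(maximalRealSubfield L)) e₁ (realDiagonal L dV hdV) (TW (↥(maximalRealSubfield L)) ε)) v)).comp
        ((chiLocalSplittingsCM L e₁ dV hdV hdV0 (toHeckeCharacter L μ) ((isOscillatorChar_toHeckeCharacter_iff μ).mpr hμ) ε).s v)).comp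
        ((localLineInl L (IsCMField.complexConj L) 3 e₁ (Matrix.diagonal dV) (JW (↥(maximalRealSubfield L)) L ε) v).comp
          ((localPiEquiv L (IsCMField.complexConj L) 3 (Matrix.diagonal dV) v).symm.toMonoidHom.comp
            (cmDatumLocalCongr L v T ha h).toMonoidHom))).comp (cmBorelTriple L 3 v).N.subtype))
    (σ : Representation ℂ (localPi L (IsCMField.complexConj L) 1 (JW (↥(maximalRealSubfield L)) L ε) v) S₁)
    (hσ : ∀ (u : localPi L (IsCMField.complexConj L) 1 (JW (↥(maximalRealSubfield L)) L ε) v)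
      (f : SchwartzBruhat (Fin n' → v.adicCompletion ↥(maximalRealSubfield L))),
      π (MpPsi.toRep (localSchrodinger (↥(maximalRealSubfield L)) n'
          (gram (↥(maximalRealSubfield L)) e₁ (realDiagonal L dV hdV) (TW (↥(maximalRealSubfield L)) ε)) v)
        ((chiLocalSplittingsCM L e₁ dV hdV hdV0 (toHeckeCharacter L μ) ((isOscillatorChar_toHeckeCharacter_iff μ).mpr hμ) ε).s v
          (localCenter L (IsCMField.complexConj L) n' (Matrix.reindex e₁ e₁ (Matrix.diagonal dV ⊗ₖ JW (↥(maximalRealSubfield L)) L ε))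
            (JW (↥(maximalRealSubfield L)) L ε) (JW_apply_ne_zero (↥(maximalRealSubfield L)) L ε) v u)) f) = σ u (π f))
    (Tr : S₁ ≃ₗ[ℂ] SchwartzBruhat (Fin n₀ → v.adicCompletion ↥(maximalRealSubfield L)))
    (hTr : ∀ (u : localPi L (IsCMField.complexConj L) 1 (JW (↥(maximalRealSubfield L)) L ε) v) (s : S₁),
      lineWeilCM L e₀ (kernelLineCM dV) (complexConj_kernelLineCM dV hdV) (kernelLineCM_ne_zero dV hdV0) μ hμ ε v u (Tr s) =
        ((((toHeckeCharacter L μ).semilocalComponent L v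
          ((localDet (IsCMField.complexConj L) v
            (isUnit_iff_ne_zero.mpr (by rw [Matrix.det_fin_one]; exact JW_apply_ne_zero (↥(maximalRealSubfield L)) L ε))
            (localPiEquiv L (IsCMField.complexConj L) 1 (JW (↥(maximalRealSubfield L)) L ε) v u) :
              ↥(normOneUnits (conjLocal L (IsCMField.complexConj L) v))) : (UnitaryGroup.LocalRing L v)ˣ))⁻¹ : ℂˣ) : ℂ) • Tr (σ u s)) :
    Nonempty (((cmBorelTriple L 3 v).restrict (xThetaGqsCM L e₁ dV hdV hdV0 μ hμ χf ε v T ha h)).Coinvariants ≃ₗ[ℂ]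
      ↥(weightSpace (lineWeilCM L e₀ (kernelLineCM dV) (complexConj_kernelLineCM dV hdV) (kernelLineCM_ne_zero dV hdV0) μ hμ ε v) id
        (fun u => ((ψθ (localDet (IsCMField.complexConj L) v
          (isUnit_iff_ne_zero.mpr (by rw [Matrix.det_fin_one]; exact JW_apply_ne_zero (↥(maximalRealSubfield L)) L ε))
          (localPiEquiv L (IsCMField.complexConj L) 1 (JW (↥(maximalRealSubfield L)) L ε) v u)) : ℂˣ) : ℂ)))) := by
  obtain ⟨hker', hσ'⟩ := chart_omegaLoc_of_chart_toRep L e₁ dV hdV hdV0 μ hμ ε v T ha h π hker σ hσ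
  exact nonempty_jacquet_xThetaGqsCM_equiv_weightSpace_of_continuous L e₁ dV hdV hdV0 e₀ μ hμ χf ε v hv hχf ψθ hψθ T ha h π hπ hker' σ hσ' Tr hTr

end Summit.HodgeConjecture.HodgeConjecture.Cruxes.H413.F0P2oThetaTypeJacquetSocketSpelling

end
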